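import Summits.BirchSwinnertonDyer.BirchSwinnertonDyer.Theorems.PrintCf2RubinValueTwoColemanCoinvariantCharTraceEllipticUnitsTowerDataOffsetLevelEllipticMoment
import Summits.BirchSwinnertonDyer.BirchSwinnertonDyer.Theorems.PrintCf2RubinValueTwoSeamColemanDictionaryLevel
import HarnessLib

/-!
# Brick (c) at `p = 2`, the SEAM at one `𝔓` and one unramified level, FOR THE ELLIPTIC UNITS: the weight-`k`, level-`m` reading of the
# (c)-capstone's divided series `L` at the trivial unramified character — `Σ_τ τ(mom_k(r_{e(𝔟),m})) = (Tr θ_m)·(χ_π(σ̃_𝔟)^{k+1} − N𝔟)·L(0; γ^{k+1} − 1)·mom_k(1)`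

Cell `bsd-print-cf2`, width seat `bsd-line-cf2c-w7` g31, route C `PrintCf2RubinValueTwo`, crux of record stmt-BirchSwinnertonDyer-24033
`TwoVariableMainConjAtSplitTwoQuad` (23720 nominal), BRICK §4(c), memo v12 (M2)(i); `--supports` the crux as a helper.  THEOREMS ONLY (0 sorry,
no named fact asserted, no definition); CONDITIONAL on the published named facts `DeShalit1987.prop24_iii`, `prop25_i` carried as hypotheses by the
elliptic-unit files.  Theses-free.  BSD is not proved by any of this.

`…SeamColemanDictionaryLevel.sum_coordMoment_relUnitCoordTwo_eq_of_colemanDeltaCoinvFun_indexTraceₗ_eq` (β-agnostic) is read here on the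
two-variable elliptic units `e(𝔟)` of the (c)-lane (frame and binders of `…TowerDataOffsetLevelEllipticMoment`, UNIVERSAL `π` — so `π := u·2`
specialises to the measure lane's frame with no transport): GIVEN the relation `hL` of the capstone at ONE liftable `𝔟` (supplied for all `𝔟`
by `…ResidualDischarged`, T9′) and an Amice element `g_𝔟` (`g_𝔟(0) = 1`), for every level `m` and weight `k ≡ parity(ε)`:

* ★★★ `sum_coordMoment_ellipticUnits_eq_of_colemanDeltaCoinvFun_eq` —
  **`Σ_{τ ∈ Gal(E_m/F)} τ(mom_k(r_{e(𝔟),m})) = (Σ_τ τθ_m) · ((χ_π(σ̃_𝔟)^{k+1} − N𝔟) · tEval_{a_k}(κ_m L) · mom_k(1))`**, `e(𝔟)` the raw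
  norm-coherent elliptic units at level `m` (`extendDown … (ellipticUnitsLocal₂ …) m`; their Coleman coordinate is that of `⟨e(𝔟)⟩`,
  `relUnitCoordTwo_principalPart`) — de Shalit II §4.12 (31) «`(N𝔞 − ψ(𝔞)^k)∫κ^k dμ = δ_k(e(𝔞))`» on the series side at the trivial character
  of the unramified direction; each `mom_k(r_{e(𝔟),m})` is the `k`-th Coates–Wiles value (`coordMoment_relUnitCoordTwo_eq_coatesWiles`) and,
  in the measure lane's currency, `ε_ϑ^{−k} j⁻¹([S⁰] D^k (j(Φ r) ∘ ϑ))` (`PAdicOneVariableSeriesFamilyOfColemanCoordModule`).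

HONEST LABEL (pen rail (i), 2026-08-31): this is the **trivial-character component of the level-m identity; NOT the level-m identity** — the
non-trivial characters of `Gal(E_m/F)` need the `X ↦ ζ − 1` base change of `Λ` ((M2)(i)′ of memo v13, not in the tree).

## References
* [deShalit1987] E. de Shalit, *Iwasawa theory of elliptic curves with complex multiplication* (1987), I §3.5 (11), §3.8 (16)–(17); II §4.7 (15)–(17),
  §4.12 (29)–(33), §4.14; III §1.3, §1.8 (14)–(15), §1.10 (17).
-/

noncomputable section

set_option linter.dupNamespace false
set_option autoImplicit false

open Filter Topology
open scoped PowerSeries.WithPiTopology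
open scoped NumberField Classical

namespace Summit.BirchSwinnertonDyer.BirchSwinnertonDyer.Theorems.PrintCf2.SeamColemanDictionaryLevelEllipticUnits

open Field IsDedekindDomain IsDedekindDomain.HeightOneSpectrum ValuativeRel WithZero
open Literature.NumberTheory.NumberFields
open Literature.NumberTheory.GaloisRepresentations Literature.NumberTheory.GaloisRepresentations.IsNonarchimedeanLocalField
  Literature.NumberTheory.GaloisRepresentations.LubinTate Literature.NumberTheory.GaloisRepresentations.ArtinLocalGlobal
open Literature.NumberTheory.EllipticCurves
open Literature.NumberTheory.ComplexMultiplication.EllipticUnits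
open Literature.NumberTheory.LFunctions.AbelianDensity (artinSymbol)
open Literature.RingTheory.PowerSeries (maxEval)
open Summit.BirchSwinnertonDyer.BirchSwinnertonDyer.Theorems.PrintCf2.ColemanImage
open Summit.BirchSwinnertonDyer.BirchSwinnertonDyer.Theorems.PrintCf2.ColemanCoinvariantGalois
open Summit.BirchSwinnertonDyer.BirchSwinnertonDyer.Theorems.PrintCf2.ColemanCoinvariantArtin
open Summit.BirchSwinnertonDyer.BirchSwinnertonDyer.Theorems.PrintCf2.EllipticUnitsLocal
open Summit.BirchSwinnertonDyer.BirchSwinnertonDyer.Theorems.PrintCf2.EllipticUnitsLocal₂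
open Summit.BirchSwinnertonDyer.BirchSwinnertonDyer.Theorems.PrintCf2.ColemanCoinvariantEllipticUnits
open Summit.BirchSwinnertonDyer.BirchSwinnertonDyer.Theorems.PrintCf2.ColemanCoinvariantEllipticUnitsLiftable
open Summit.BirchSwinnertonDyer.BirchSwinnertonDyer.Theorems.PrintCf2.ColemanCoinvariantTrace
open Summit.BirchSwinnertonDyer.BirchSwinnertonDyer.Theorems.PrintCf2.ColemanCoinvariantTraceEllipticUnits
open Summit.BirchSwinnertonDyer.BirchSwinnertonDyer.Theorems.PrintCf2.ColemanCoinvariantTraceEllipticUnitsTowerDataOffset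
open Summit.BirchSwinnertonDyer.BirchSwinnertonDyer.Theorems.PrintCf2.ColemanCoinvariantTraceEllipticUnitsTowerDataOffsetIndex
open Summit.BirchSwinnertonDyer.BirchSwinnertonDyer.Theorems.PrintCf2.ColemanCoinvariantTraceEllipticUnitsTowerDataOffsetMoment
open Summit.BirchSwinnertonDyer.BirchSwinnertonDyer.Theorems.PrintCf2.SeamColemanDictionaryLevel

variable {K : Type} [Field K] [NumberField K] {𝔤₀ : Ideal (𝓞 K)} {v v' : HeightOneSpectrum (𝓞 K)}

attribute [local instance] ltNormUniformSpace ltNormIsUniformAddGroup rk1 nF nE fintypeResidueField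
attribute [local instance] RelNormCoherentUnits.instCommMonoid

/-- `v ∤ 𝔤₀v'^ν` for `v ∤ 𝔤₀`, `v ≠ v'`. [cite: deShalit1987, II.4.14 (p. 71)] -/
private theorem not_mul_pow_le₃₅ (hv : ¬ 𝔤₀ ≤ v.asIdeal) (hvv' : v' ≠ v) (n : ℕ) : ¬ 𝔤₀ * v'.asIdeal ^ n ≤ v.asIdeal := by
  intro h
  rcases (v.isPrime.mul_le).mp h with h1 | h2
  · exact hv h1
  · rcases n with _ | n
    · rw [pow_zero, Ideal.one_eq_top, top_le_iff] at h2
      exact v.isPrime.ne_top h2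
    · exact hvv' (HeightOneSpectrum.ext ((v'.isMaximal.eq_of_le v.isPrime.ne_top ((Ideal.IsPrime.pow_le_iff (hP := v.isPrime)
        (Nat.succ_ne_zero n)).mp h2))))

section Capstone

attribute [local instance] isAdicComplete_maximalIdeal_powerSeries_integer

variable [NumberField.IsTotallyComplex K]
  (h24iii : DeShalit1987.prop24_iii_unit) (h25 : DeShalit1987.prop25_i_normRelation) (h24ii : DeShalit1987.prop24_ii_galoisAction)
  (hK : IsImaginaryQuadratic K) (ιK : K →+* ℂ)
  -- the global data: `𝔤₀`, the auxiliary prime `v'` (degree one, absolutely unramified over `p`), ONE element `α`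
  (h𝔤0 : 𝔤₀ ≠ ⊥) (hv : ¬ 𝔤₀ ≤ v.asIdeal) (hv' : ¬ 𝔤₀ ≤ v'.asIdeal) (hvv' : v' ≠ v)
  (hw𝔤 : ∀ u : (𝓞 K)ˣ, (u : 𝓞 K) - 1 ∈ 𝔤₀ → u = 1)
  {p : ℕ} [hp : Fact p.Prime] (hdeg1 : Nat.card (𝓞 K ⧸ v'.asIdeal) = p) (hpv' : (p : 𝓞 K) ∈ v'.asIdeal) (hpv'2 : (p : 𝓞 K) ∉ v'.asIdeal ^ 2)
  {π : 𝒪[v.adicCompletion K]} (hπ : (valuation (v.adicCompletion K)).IsUniformizer (π : v.adicCompletion K))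
  {α : 𝓞 K} (hα0 : α ≠ 0) (hα𝔤 : α - 1 ∈ 𝔤₀) (hαw : ∀ w : HeightOneSpectrum (𝓞 K), w ≠ v → α ∉ w.asIdeal)
  {f : ℕ} (hαf : Ideal.span {α} = v.asIdeal ^ f) (hαπ : ((α : K) : v.adicCompletion K) = (π : v.adicCompletion K) ^ f)
  {ℓ ν : ℕ} (hℓ : 1 ≤ ℓ) (hαℓ : v'.intValuation (α - 1) = exp (-(ℓ : ℤ)))
  (ha2 : 2 ≤ ν + 1 ∨ p ≠ 2) (hαa : v'.intValuation (α ^ p - 1) = exp (-((ν + 1 : ℕ) : ℤ)))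
  [CharZero (v.adicCompletion K)]
  -- the residue degree `f = d₀·p^r` of `v` in `K(𝔤₀v'^ν)` (2-power part `p^r` INCLUDED; `f ∣ o(𝔤₀v'^ν)` ONLY) and the local frame on the trace
  {d₀ r : ℕ} (hd : d₀.Coprime p) (hf : f = d₀ * p ^ r) (hfo : f ∣ orderOf (galFrob K (rayClassField K (𝔤₀ * v'.asIdeal ^ ν)) v))
  (E : ℕ → IntermediateField (v.adicCompletion K) (AlgebraicClosure (v.adicCompletion K)))
  [∀ j, FiniteDimensional (v.adicCompletion K) (E j)] [∀ j, Normal (v.adicCompletion K) (E j)] [∀ j, IsGalois (v.adicCompletion K) (E j)]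
  (hmono : Monotone E) (hE : ∀ j, E j ≤ maxUnramified (v.adicCompletion K)) (hdeg : ∀ j, Module.finrank (v.adicCompletion K) (E j) = d₀ * p ^ j)
  {σ₀ : absoluteGaloisGroup (v.adicCompletion K)} (hσ₀ : IsAbsArithFrob σ₀) (hq : residueFieldCard (v.adicCompletion K) = 2)
  (u : (LTCoeff (v.adicCompletion K))ˣ) (hu : LTCoeff.of (v.adicCompletion K) π = residueFieldCard (v.adicCompletion K) * u)
  (γ w : 𝒪[v.adicCompletion K]ˣ) (hγ : (γ : 𝒪[v.adicCompletion K]) = 1 + π ^ 2 * w)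
  [IsAdicComplete (Ideal.span {intBase (v.adicCompletion K) (LTCoeff.of (v.adicCompletion K) π)}) (PowerSeries 𝒪[v.adicCompletion K])]
  [NeZero d₀]
  {θ : ∀ j, unitBall (E j)} (hθ : ∀ j, IsIntegralNormalGen (E j) (θ j))
  (hcoh : ∀ j, unitBallTrace (hmono (Nat.le_succ j)) (θ (j + 1)) = θ j)
  [IsAdicComplete (Ideal.span {(p : 𝒪[v.adicCompletion K])}) 𝒪[v.adicCompletion K]]
  (hI : Ideal.span {(p : 𝒪[v.adicCompletion K])} ≠ ⊤)
  (hud : ∀ j, (u : LTCoeff (v.adicCompletion K)) ^ Module.finrank (v.adicCompletion K) (E j) ≠ 1)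
  (hm : ∃ m₁ : ℕ, LTCoeff.of (v.adicCompletion K) π ^ 2 ∣ LTCoeff.of (v.adicCompletion K) π - m₁)
  (hN : DenseRange (Nat.cast : ℕ → 𝒪[v.adicCompletion K]))
  -- theta families and local lifts indexed by the liftable ideals of the tower `𝔤 = 𝔤₀v'^ν`
  (x : ∀ a : {𝔞 : Ideal (𝓞 K) // IsLocArtinLiftable (𝔤₀ * v'.asIdeal ^ ν) v v' 𝔞}, ∀ i k : ℕ,
    rayClassField K (𝔤₀ * v'.asIdeal ^ ν * v'.asIdeal ^ (i + 1) * v.asIdeal ^ (k + 1)))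
  (hx : ∀ a, ∀ i k : ℕ, IsThetaValueOne ιK (𝔤₀ * v'.asIdeal ^ ν * v'.asIdeal ^ (i + 1) * v.asIdeal ^ (k + 1)) (a.1 : Ideal (𝓞 K))
    (algClosureEmb ιK ((x a i k : rayClassField K (𝔤₀ * v'.asIdeal ^ ν * v'.asIdeal ^ (i + 1) * v.asIdeal ^ (k + 1))) : AlgebraicClosure K)))
  (σ : {𝔞 : Ideal (𝓞 K) // IsLocArtinLiftable (𝔤₀ * v'.asIdeal ^ ν) v v' 𝔞} → absoluteGaloisGroup (v.adicCompletion K))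
  (hσ : ∀ a, ∀ i k : ℕ, absRestrictNormalHom (rayClassField K (𝔤₀ * v'.asIdeal ^ ν * v'.asIdeal ^ (i + 1) * v.asIdeal ^ (k + 1)))
      (absGaloisRestrict K (v.adicCompletion K) (σ a)) =
    artinSymbol (galFrob K (rayClassField K (𝔤₀ * v'.asIdeal ^ ν * v'.asIdeal ^ (i + 1) * v.asIdeal ^ (k + 1)))) (a.1 : Ideal (𝓞 K)))
  (ε : PowerSeries (PowerSeries 𝒪[v.adicCompletion K]))
  (g : {𝔞 : Ideal (𝓞 K) // IsLocArtinLiftable (𝔤₀ * v'.asIdeal ^ ν) v v' 𝔞} → (PowerSeries 𝒪[v.adicCompletion K])ˣ)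


set_option maxHeartbeats 800000 in
/-- ★★★ **THE WEIGHT-`k`, LEVEL-`m` READING OF `L` ON THE ELLIPTIC UNITS, TRIVIAL UNRAMIFIED CHARACTER** (de Shalit II §4.12 (31), series side, one
prime above `v`, `q = 2`): in the frame of `…TowerDataOffsetLevelEllipticMoment`, GIVEN at one liftable `𝔟` an Amice element `g_𝔟` (`g_𝔟(0) = 1`) and
the capstone relation `φ_ε(Σ_j Col⟨e(𝔟)⟩(j)) = (t_{χ(σ̃_𝔟)}·C g_𝔟 − N𝔟)·L`, for every level `m` and weight `k` with `κ_m ε = (−1)^{k+1}`: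
**`Σ_{τ ∈ Gal(E_m/F)} τ(mom_k(r_{e(𝔟),m})) = (Σ_τ τθ_m)·((χ_π(σ̃_𝔟)^{k+1} − N𝔟)·tEval_{γ^{k+1}−1}(κ_m L)·mom_k(1))`**
(trivial-character component of the level-`m` identity; NOT the level-`m` identity).
[cite: deShalit1987, I §3.5 (11), §3.8 (16)–(17); II §4.7 (17), §4.12 (29)–(31), §4.14; III §1.8 (14)–(15)] -/
theorem sum_coordMoment_ellipticUnits_eq_of_colemanDeltaCoinvFun_eq
    (b : {𝔞 : Ideal (𝓞 K) // IsLocArtinLiftable (𝔤₀ * v'.asIdeal ^ ν) v v' 𝔞})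
    (hg₀ : PowerSeries.constantCoeff (g b : PowerSeries 𝒪[v.adicCompletion K]) = 1) (L : PowerSeries (PowerSeries 𝒪[v.adicCompletion K]))
    (hLb : colemanDeltaCoinvFun hπ hq (intBase (v.adicCompletion K)) u hu γ (eq_zero_of_C_pi_mul_eq_zero_integer hπ) w hγ ε
        (indexTraceₗ hπ hq u hu γ (colemanImage hd hπ E hmono hE hdeg hσ₀ hq u hu γ hθ hcoh
          (closure_unitsGen_subset_principalCoherentFamilies hπ E hmono
            (fun b ↦ ellipticUnitsPrincipal₂ h24iii h25 hK ιK
                (mul_ne_zero h𝔤0 (pow_ne_zero ν v'.ne_bot))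
                (not_mul_pow_le₃₅ hv hvv' ν) hvv'
                (hw_of_towerData hw𝔤) hπ
                (towerData_hα0 (p := p) hα0)
                (towerData_hα𝔪 hv' hp.out hpv' hpv'2 hα𝔤 ha2 hαa)
                (towerData_hαw (p := p) hαw)
                (towerData_hαπ (p := p) hαπ) E hmono (r + 1) (fun i ↦ hE (i + (r + 1)))
                (towerDataOffset_hdegE hf E hE hdeg)
              b.2.1 b.2.2.1 (x b) (hx b))
            (fun b ↦ ellipticUnitsPrincipal₂_mem_principalCoherentFamilies h24iii h25 hK ιK
                (mul_ne_zero h𝔤0 (pow_ne_zero ν v'.ne_bot))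
                (not_mul_pow_le₃₅ hv hvv' ν) hvv'
                (hw_of_towerData hw𝔤) hπ
                (towerData_hα0 (p := p) hα0)
                (towerData_hα𝔪 hv' hp.out hpv' hpv'2 hα𝔤 ha2 hαa)
                (towerData_hαw (p := p) hαw)
                (towerData_hαπ (p := p) hαπ) E hmono (r + 1)
              (fun i ↦ hE (i + (r + 1)))
                  (towerDataOffset_hdegE hf E hE hdeg) b.2.1 b.2.2.1 (fun i ↦
                  (towerDataOffset_hinert_of_level h𝔤0 hv hv' hvv' hw𝔤 hp.out hpv' hpv'2 hπ hα0 hα𝔤 hαf hℓ hαℓ ha2 hαa hfo E hE (r + 1) (finrank_add_offset_eq E hf hdeg)) (i + 1))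
                  (towerDataOffset_hcount h𝔤0 hv' hvv' hw𝔤 hp.out hdeg1 hpv' hpv'2 E hdeg) (x b) (hx b))
            (mem_closure_unitsGen hπ E _ b)).1)) =
      (colemanDeltaCoinvFun hπ hq (intBase (v.adicCompletion K)) u hu γ (eq_zero_of_C_pi_mul_eq_zero_integer hπ) w hγ ε
          (unitTwistₗ hπ hq (intBase (v.adicCompletion K)) u hu γ (lubinTateChar hπ (σ b)) (TActModule.ofPS _ _ 1)) *
          PowerSeries.C (g b : PowerSeries 𝒪[v.adicCompletion K]) - PowerSeries.C ((Ideal.absNorm (b.1 : Ideal (𝓞 K)) : ℕ) : PowerSeries 𝒪[v.adicCompletion K])) * L)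
    (mm kk : ℕ) [IsAdicComplete (Ideal.span {algebraMap (LTCoeff (v.adicCompletion K)) (unitBall (E mm)) (LTCoeff.of (v.adicCompletion K) π)})
      (unitBall (E mm))]
    (hεk : PowerSeries.map ((algebraMap 𝒪[v.adicCompletion K] (unitBall (E mm))).comp
      (PowerSeries.constantCoeff (R := 𝒪[v.adicCompletion K]))) ε = (-1) ^ (kk + 1)) :
    ∑ τ : E mm ≃ₐ[v.adicCompletion K] E mm, unitBallEquiv (E mm) τ (coordMoment hπ (E mm) u kk
      (relUnitCoordTwo hπ (E mm) hq (hE mm) hσ₀ u hu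
        (extendDown hπ E hmono (r + 1) (ellipticUnitsLocal₂ h24iii h25 hK ιK
                    (mul_ne_zero h𝔤0 (pow_ne_zero ν v'.ne_bot))
                    (not_mul_pow_le₃₅ hv hvv' ν) hvv'
                    (hw_of_towerData hw𝔤) hπ
                    (towerData_hα0 (p := p) hα0)
                    (towerData_hα𝔪 hv' hp.out hpv' hpv'2 hα𝔤 ha2 hαa)
                    (towerData_hαw (p := p) hαw)
                    (towerData_hαπ (p := p) hαπ) (fun i ↦ E (i + (r + 1)))
                  (fun i ↦ hE (i + (r + 1)))
                      (towerDataOffset_hdegE hf E hE hdeg) b.2.1 b.2.2.1 (x b) (hx b)) mm))) =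
      (∑ τ : E mm ≃ₐ[v.adicCompletion K] E mm, unitBallEquiv (E mm) τ (θ mm)) *
        ((algebraMap 𝒪[v.adicCompletion K] (unitBall (E mm)) (lubinTateChar hπ (σ b) : 𝒪[v.adicCompletion K]) ^ (kk + 1) -
            ((Ideal.absNorm (b.1 : Ideal (𝓞 K)) : ℕ) : unitBall (E mm))) *
          tEval (algebraMap_unit_pow_sub_one_mem hπ (E mm) hq γ kk)
            (PowerSeries.map ((algebraMap 𝒪[v.adicCompletion K] (unitBall (E mm))).comp (PowerSeries.constantCoeff (R := 𝒪[v.adicCompletion K]))) L) *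
          coordMoment hπ (E mm) u kk 1) := by
  have h := sum_coordMoment_relUnitCoordTwo_eq_of_colemanDeltaCoinvFun_indexTraceₗ_eq hd hπ E hmono hE hdeg hσ₀ hq u hu γ w hγ ε hθ hcoh
    (β := (ellipticUnitsPrincipal₂ h24iii h25 hK ιK
        (mul_ne_zero h𝔤0 (pow_ne_zero ν v'.ne_bot))
        (not_mul_pow_le₃₅ hv hvv' ν) hvv'
        (hw_of_towerData hw𝔤) hπ
        (towerData_hα0 (p := p) hα0)
        (towerData_hα𝔪 hv' hp.out hpv' hpv'2 hα𝔤 ha2 hαa)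
        (towerData_hαw (p := p) hαw)
        (towerData_hαπ (p := p) hαπ) E hmono (r + 1) (fun i ↦ hE (i + (r + 1)))
        (towerDataOffset_hdegE hf E hE hdeg)
      b.2.1 b.2.2.1 (x b) (hx b)))
    _ (lubinTateChar hπ (σ b)) (g b : PowerSeries 𝒪[v.adicCompletion K]) hg₀ (Ideal.absNorm (b.1 : Ideal (𝓞 K))) L hLb mm kk hεk
  have e : (ellipticUnitsPrincipal₂ h24iii h25 hK ιK
        (mul_ne_zero h𝔤0 (pow_ne_zero ν v'.ne_bot))
        (not_mul_pow_le₃₅ hv hvv' ν) hvv'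
        (hw_of_towerData hw𝔤) hπ
        (towerData_hα0 (p := p) hα0)
        (towerData_hα𝔪 hv' hp.out hpv' hpv'2 hα𝔤 ha2 hαa)
        (towerData_hαw (p := p) hαw)
        (towerData_hαπ (p := p) hαπ) E hmono (r + 1) (fun i ↦ hE (i + (r + 1)))
        (towerDataOffset_hdegE hf E hE hdeg)
      b.2.1 b.2.2.1 (x b) (hx b)) mm =
      (extendDown hπ E hmono (r + 1) (ellipticUnitsLocal₂ h24iii h25 hK ιK
                    (mul_ne_zero h𝔤0 (pow_ne_zero ν v'.ne_bot))
                    (not_mul_pow_le₃₅ hv hvv' ν) hvv'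
                    (hw_of_towerData hw𝔤) hπ
                    (towerData_hα0 (p := p) hα0)
                    (towerData_hα𝔪 hv' hp.out hpv' hpv'2 hα𝔤 ha2 hαa)
                    (towerData_hαw (p := p) hαw)
                    (towerData_hαπ (p := p) hαπ) (fun i ↦ E (i + (r + 1)))
                  (fun i ↦ hE (i + (r + 1)))
                      (towerDataOffset_hdegE hf E hE hdeg) b.2.1 b.2.2.1 (x b) (hx b)) mm).principalPart :=
    extendDown_principalPart hπ E hmono (r + 1) _ mm
  rw [e, relUnitCoordTwo_principalPart] at h
  exact h

end Capstone

end Summit.BirchSwinnertonDyer.BirchSwinnertonDyer.Theorems.PrintCf2.SeamColemanDictionaryLevelEllipticUnits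

end
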